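/-
Copyright (c) 2026 the pub-hodgecm-mathlib formalisation cell (harness21).  Prover seat hodgecm-mathlib-K2E5-p16 (g5): Track B «K2-LIT»,
hLiu418 = stmt-HodgeConjecture-24832, ROAD Φ organ Φ6b-6 (β-shift of Shimura's `η` on `Herm₂(ℂ)`), file (4b-i): growth in `h` of the
WEIGHTED `η`-integrals `∫ u₁₁⁻¹ |η-int(u + h)|` (the pieces of co-dealer rider (b)); 2026-09-04.
-/
import Summits.HodgeConjecture.HodgeConjecture.Theorems.K2LiuHermTwoEtaBetaShift            -- ★ p858438: translated shifted objects
import Summits.HodgeConjecture.HodgeConjecture.Theorems.K2LiuHermTwoEtaGrowthUniform        -- ★ p858194: growth template, interpolation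
import HarnessLib

/-!
# Crux `HLiu418`, ROAD Φ, organ Φ6b-6 — file (4b-i): growth of the WEIGHTED `η`-integrals `∫_{u>0} u₁₁⁻¹ |η-int(a)(u + h)| du` in `h`

Cell `hodgecm-mathlib`, crux item hLiu418 = `stmt-HodgeConjecture-24832`, route of record `HCCMUnconditional`; squad K2, LEAD F0P6-plan (g12),
co-dealer K2E5-plan (g6) (rider (b) 2026-09-04 07:41:05Z), prover K2E5-p16 (g5).  THEOREMS ONLY; lane `--supports stmt-HodgeConjecture-24832 --as helper`.

WHAT.  The WEIGHTED twins of ★ g4's growth pieces (`K2LiuHermTwoEtaGrowth`), the weight being the `u₁₁⁻¹ = ((u+h) − h)₁₁⁻¹` of the β-shift: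
* `norm_inv_mul_etaTwoIntegrand_add_le_of_two_le ∕ _of_lt_two` — ★ `norm_etaTwoIntegrand_add_le_of_two_le ∕ _of_lt_two` multiplied by `u₁₁⁻¹`
  (for `a < 2` against the weighted REAL Siegel–Gindikin integrand of ★ (M1));
* `integral_norm_inv_mul_etaTwoIntegrand_add_le (hd) (hβ : 1 < re β) (a : ℝ)` — there is an h-FREE `C ≥ 0` with
  `∫_{u>0} u₁₁⁻¹ |η-int(g, h; a, β)(u + h)| du ≤ C · e^{−τ(hg)} · (1 + tr h)^{2(a−2)⁺} · det(h)^{−(2−a)⁺}` for every `h > 0`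
  (`C` = integral of ★ `integrableOn_inv_mul_etaTwoIntegrand_comp_add` at `h = ½`, resp. of ★ (M1) `integrableOn_inv_snd_mul_siegelGindikin`);
* two elementary inequalities for the three-factor shape: `(1 + x⁻¹)(1 + x^{−N}) ≤ 2(1 + x^{−(N+1)})`, `(1 + t)^N (1 + t) = (1 + t)^{N+1}`.
Consumer: `K2LiuHermTwoEtaShiftGrowth.norm_etaShift_le₂` (file (4b-ii)).
HONEST LABEL.  Count-neutral helper of the K2_Liu road; it pays no socket by itself: `HC_CM` is proved only modulo the 7 printed citations
(2 remaining named inputs: hLiu418 = `stmt-HodgeConjecture-24832`, h413 = `stmt-HodgeConjecture-24833`) until rung 0 closes.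
-/

set_option autoImplicit false
-- the mandated namespace repeats the single-problem summit's segment (`HodgeConjecture.HodgeConjecture`)
set_option linter.dupNamespace false

noncomputable section

open Complex MeasureTheory Set
open scoped ComplexOrder ComplexConjugate

namespace Summit.HodgeConjecture.HodgeConjecture.Cruxes.HLiu418.K2LiuHermTwoInvMulEtaGrowth

open Summit.HodgeConjecture.HodgeConjecture.Cruxes.HLiu418.K2LiuHermTwoGammaDefs
open Summit.HodgeConjecture.HodgeConjecture.Cruxes.HLiu418.K2LiuHermTwoGammaSiegelGindikin
open Summit.HodgeConjecture.HodgeConjecture.Cruxes.HLiu418.K2LiuHermTwoEtaDefs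
open Summit.HodgeConjecture.HodgeConjecture.Cruxes.HLiu418.K2LiuHermTwoEtaConvergence
open Summit.HodgeConjecture.HodgeConjecture.Cruxes.HLiu418.K2LiuHermTwoEtaGrowth
open Summit.HodgeConjecture.HodgeConjecture.Cruxes.HLiu418.K2LiuHermTwoEtaGrowthUniform
open Summit.HodgeConjecture.HodgeConjecture.Cruxes.HLiu418.K2LiuHermTwoConeInvEntryIntegrable
open Summit.HodgeConjecture.HodgeConjecture.Cruxes.HLiu418.K2LiuHermTwoEtaShiftDefs
open Summit.HodgeConjecture.HodgeConjecture.Cruxes.HLiu418.K2LiuHermTwoEtaShiftConvergence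
open Summit.HodgeConjecture.HodgeConjecture.Cruxes.HLiu418.K2LiuHermTwoEtaBetaShift

/-! ## The weighted translated integrand: pointwise bounds -/

/-- THE NORM OF THE WEIGHTED TRANSLATED INTEGRAND: for `u` in the cone, `|((u+h) − h)₁₁⁻¹ · η-int(u + h)| = u₁₁⁻¹ · |η-int(u + h)|`. -/
theorem norm_inv_mul_etaTwoIntegrand_add (g : Matrix (Fin 2) (Fin 2) ℂ) (e : ℝ × ℂ × ℝ) {u : ℝ × ℂ × ℝ} (hu : (hermTwo u).PosDef)
    (γ β : ℂ) :
    ‖((hermTwo (u + e) - hermTwo e) 1 1)⁻¹ * etaTwoIntegrand g (hermTwo e) γ β (u + e)‖ =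
      u.2.2⁻¹ * ‖etaTwoIntegrand g (hermTwo e) γ β (u + e)‖ := by
  have hu' := (posDef_hermTwo_iff u).mp hu
  have hy : 0 < u.2.2 := snd_pos_of_cone hu'.1 hu'.2
  rw [norm_mul, hermTwo_add_sub_apply_one_one, norm_inv, Complex.norm_of_nonneg hy.le]

/-- THE WEIGHTED BOUND AT A REAL EXPONENT `a ≥ 2` (★ `norm_etaTwoIntegrand_add_le_of_two_le` times `u₁₁⁻¹`). -/
theorem norm_inv_mul_etaTwoIntegrand_add_le_of_two_le (d : ℝ × ℂ × ℝ) {e : ℝ × ℂ × ℝ} (he : (hermTwo e).PosDef) {u : ℝ × ℂ × ℝ}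
    (hu : (hermTwo u).PosDef) {a : ℝ} (ha2 : 2 ≤ a) (β : ℂ) :
    ‖((hermTwo (u + e) - hermTwo e) 1 1)⁻¹ * etaTwoIntegrand (hermTwo d) (hermTwo e) (a : ℂ) β (u + e)‖ ≤
      (Real.exp (-(e.1 * d.1 + e.2.2 * d.2.2 + 2 * (e.2.1 * conj d.2.1).re)) * (2 * (1 + (e.1 + e.2.2))) ^ (2 * (a - 2))) *
        (Real.exp ((d.1 + d.2.2) / 2) *
          ‖((hermTwo (u + ((1 / 2 : ℝ), (0 : ℂ), (1 / 2 : ℝ))) - hermTwo ((1 / 2 : ℝ), (0 : ℂ), (1 / 2 : ℝ))) 1 1)⁻¹ *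
            etaTwoIntegrand (hermTwo d) (hermTwo ((1 / 2 : ℝ), (0 : ℂ), (1 / 2 : ℝ))) ((2 * a - 2 : ℝ) : ℂ) β
              (u + ((1 / 2 : ℝ), (0 : ℂ), (1 / 2 : ℝ)))‖) := by
  have hu' := (posDef_hermTwo_iff u).mp hu
  have hy : 0 < u.2.2 := snd_pos_of_cone hu'.1 hu'.2
  rw [norm_inv_mul_etaTwoIntegrand_add _ e hu, norm_inv_mul_etaTwoIntegrand_add _ _ hu]
  have h := mul_le_mul_of_nonneg_left (norm_etaTwoIntegrand_add_le_of_two_le d he hu ha2 β) (inv_nonneg.mpr hy.le)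
  calc _ ≤ _ := h
    _ = _ := by ring

/-- THE WEIGHTED BOUND AT A REAL EXPONENT `a < 2` (★ `norm_etaTwoIntegrand_add_le_of_lt_two` times `u₁₁⁻¹`), against the weighted REAL
Siegel–Gindikin integrand of ★ (M1). -/
theorem norm_inv_mul_etaTwoIntegrand_add_le_of_lt_two (d : ℝ × ℂ × ℝ) {e : ℝ × ℂ × ℝ} (he : (hermTwo e).PosDef) {u : ℝ × ℂ × ℝ}
    (hu : (hermTwo u).PosDef) {a : ℝ} (ha2 : a < 2) (β : ℂ) :
    ‖((hermTwo (u + e) - hermTwo e) 1 1)⁻¹ * etaTwoIntegrand (hermTwo d) (hermTwo e) (a : ℂ) β (u + e)‖ ≤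
      (Real.exp (-(e.1 * d.1 + e.2.2 * d.2.2 + 2 * (e.2.1 * conj d.2.1).re)) * (e.1 * e.2.2 - normSq e.2.1) ^ (a - 2)) *
        (u.2.2⁻¹ * (Real.exp (-(u.1 * d.1 + u.2.2 * d.2.2 + 2 * (u.2.1 * conj d.2.1).re)) * (u.1 * u.2.2 - normSq u.2.1) ^ (β.re - 2))) := by
  have hu' := (posDef_hermTwo_iff u).mp hu
  have hy : 0 < u.2.2 := snd_pos_of_cone hu'.1 hu'.2
  rw [norm_inv_mul_etaTwoIntegrand_add _ e hu]
  have h := mul_le_mul_of_nonneg_left (norm_etaTwoIntegrand_add_le_of_lt_two d he hu ha2 β) (inv_nonneg.mpr hy.le)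
  rw [norm_siegelGindikin_integrand d (β.re : ℂ) hu', ofReal_re] at h
  calc _ ≤ _ := h
    _ = _ := by ring

/-! ## The weighted integral bound at a real exponent -/

/-- THE WEIGHTED INTEGRAL BOUND AT A REAL EXPONENT `a`: with `C` independent of `h`, for every `h = hermTwo e > 0`,
`∫_{u>0} u₁₁⁻¹ |η-int(a)(u + h)| du ≤ C · e^{−τ(hg)} · (1 + tr h)^{2(a−2)⁺} · det(h)^{−(2−a)⁺}`. -/
theorem integral_norm_inv_mul_etaTwoIntegrand_add_le {d : ℝ × ℂ × ℝ} (hd : 0 < d.1 ∧ normSq d.2.1 < d.1 * d.2.2) {β : ℂ} (hβ : 1 < β.re)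
    (a : ℝ) : ∃ C : ℝ, 0 ≤ C ∧ ∀ e : ℝ × ℂ × ℝ, (hermTwo e).PosDef →
      ∫ u in {c : ℝ × ℂ × ℝ | (hermTwo c).PosDef}, ‖((hermTwo (u + e) - hermTwo e) 1 1)⁻¹ * etaTwoIntegrand (hermTwo d) (hermTwo e) (a : ℂ) β (u + e)‖ ≤
        C * Real.exp (-(e.1 * d.1 + e.2.2 * d.2.2 + 2 * (e.2.1 * conj d.2.1).re)) *
          ((1 + (e.1 + e.2.2)) ^ (2 * max (a - 2) 0) * (e.1 * e.2.2 - normSq e.2.1) ^ (-max (2 - a) 0)) := by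
  have hg : (hermTwo d).PosDef := (posDef_hermTwo_iff d).mpr hd
  rcases le_or_gt 2 a with ha2 | ha2
  · -- `a ≥ 2`: compare with the weighted `η(g, ½; 2a − 2, β)`
    have hι : (hermTwo ((1 / 2 : ℝ), (0 : ℂ), (1 / 2 : ℝ))).PosDef := (posDef_hermTwo_iff _).mpr (by norm_num)
    have hint := (integrableOn_inv_mul_etaTwoIntegrand_comp_add hg hι (((2 * a - 2 : ℝ)) : ℂ) hβ).norm
    have hI0 : 0 ≤ ∫ u in {c : ℝ × ℂ × ℝ | (hermTwo c).PosDef},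
        ‖((hermTwo (u + ((1 / 2 : ℝ), (0 : ℂ), (1 / 2 : ℝ))) - hermTwo ((1 / 2 : ℝ), (0 : ℂ), (1 / 2 : ℝ))) 1 1)⁻¹ *
          etaTwoIntegrand (hermTwo d) (hermTwo ((1 / 2 : ℝ), (0 : ℂ), (1 / 2 : ℝ))) ((2 * a - 2 : ℝ) : ℂ) β
            (u + ((1 / 2 : ℝ), (0 : ℂ), (1 / 2 : ℝ)))‖ := integral_nonneg fun _ => norm_nonneg _
    refine ⟨(2 : ℝ) ^ (2 * (a - 2)) * (Real.exp ((d.1 + d.2.2) / 2) *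
      ∫ u in {c : ℝ × ℂ × ℝ | (hermTwo c).PosDef},
        ‖((hermTwo (u + ((1 / 2 : ℝ), (0 : ℂ), (1 / 2 : ℝ))) - hermTwo ((1 / 2 : ℝ), (0 : ℂ), (1 / 2 : ℝ))) 1 1)⁻¹ *
          etaTwoIntegrand (hermTwo d) (hermTwo ((1 / 2 : ℝ), (0 : ℂ), (1 / 2 : ℝ))) ((2 * a - 2 : ℝ) : ℂ) β
            (u + ((1 / 2 : ℝ), (0 : ℂ), (1 / 2 : ℝ)))‖), by positivity, fun e he => ?_⟩
    have heh := (posDef_hermTwo_iff e).mp he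
    have he2 : 0 < e.2.2 := snd_pos_of_cone heh.1 heh.2
    have hmono := setIntegral_mono_on (integrableOn_inv_mul_etaTwoIntegrand_comp_add hg he (a : ℂ) hβ).norm
      ((hint.const_mul _).const_mul
        (Real.exp (-(e.1 * d.1 + e.2.2 * d.2.2 + 2 * (e.2.1 * conj d.2.1).re)) * (2 * (1 + (e.1 + e.2.2))) ^ (2 * (a - 2))))
      measurableSet_posDef_hermTwo fun u hu => norm_inv_mul_etaTwoIntegrand_add_le_of_two_le d he hu ha2 β
    rw [integral_const_mul, integral_const_mul] at hmono
    rw [max_eq_left (by linarith : (0 : ℝ) ≤ a - 2), max_eq_right (by linarith : 2 - a ≤ (0 : ℝ)), neg_zero, Real.rpow_zero,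
      mul_one]
    rw [Real.mul_rpow (by norm_num : (0 : ℝ) ≤ 2) (by linarith [heh.1, he2] : (0 : ℝ) ≤ 1 + (e.1 + e.2.2))] at hmono
    calc _ ≤ _ := hmono
      _ = _ := by ring
  · -- `a < 2`: compare with the weighted real Siegel–Gindikin integrand at `(g, re β)` (★ M1)
    have hint := integrableOn_inv_snd_mul_siegelGindikin d hd (s := β.re) hβ
    have hI0 : 0 ≤ ∫ u in {c : ℝ × ℂ × ℝ | (hermTwo c).PosDef},
        u.2.2⁻¹ * (Real.exp (-(u.1 * d.1 + u.2.2 * d.2.2 + 2 * (u.2.1 * conj d.2.1).re)) * (u.1 * u.2.2 - normSq u.2.1) ^ (β.re - 2)) := by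
      refine setIntegral_nonneg measurableSet_posDef_hermTwo fun u hu => ?_
      have hu' := (posDef_hermTwo_iff u).mp hu
      exact mul_nonneg (inv_nonneg.mpr (snd_pos_of_cone hu'.1 hu'.2).le) (siegelGindikin_real_nonneg d β.re hu')
    refine ⟨∫ u in {c : ℝ × ℂ × ℝ | (hermTwo c).PosDef},
        u.2.2⁻¹ * (Real.exp (-(u.1 * d.1 + u.2.2 * d.2.2 + 2 * (u.2.1 * conj d.2.1).re)) * (u.1 * u.2.2 - normSq u.2.1) ^ (β.re - 2)),
      hI0, fun e he => ?_⟩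
    have heh := (posDef_hermTwo_iff e).mp he
    have hmono := setIntegral_mono_on (integrableOn_inv_mul_etaTwoIntegrand_comp_add hg he (a : ℂ) hβ).norm
      (hint.const_mul (Real.exp (-(e.1 * d.1 + e.2.2 * d.2.2 + 2 * (e.2.1 * conj d.2.1).re)) * (e.1 * e.2.2 - normSq e.2.1) ^ (a - 2)))
      measurableSet_posDef_hermTwo fun u hu => norm_inv_mul_etaTwoIntegrand_add_le_of_lt_two d he hu ha2 β
    rw [integral_const_mul] at hmono
    rw [max_eq_right (by linarith : a - 2 ≤ (0 : ℝ)), max_eq_left (by linarith : (0 : ℝ) ≤ 2 - a), mul_zero, Real.rpow_zero,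
      one_mul, neg_sub]
    calc _ ≤ _ := hmono
      _ = _ := by ring

/-! ## Two elementary inequalities for the three-factor shape -/

/-- For `x > 0`, `N ≥ 0`: `(1 + x⁻¹)(1 + x^{−N}) ≤ 2 (1 + x^{−(N+1)})` (both `1 − x⁻¹` and `1 − x^{−N}` have the sign of `x − 1`). -/
theorem one_add_inv_mul_one_add_rpow_neg_le {x N : ℝ} (hx : 0 < x) (hN : 0 ≤ N) :
    (1 + x⁻¹) * (1 + x ^ (-N)) ≤ 2 * (1 + x ^ (-(N + 1))) := by
  have hsplit : x ^ (-(N + 1)) = x⁻¹ * x ^ (-N) := by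
    rw [show -(N + 1) = (-1) + (-N) by ring, Real.rpow_add hx, Real.rpow_neg_one]
  rw [hsplit]
  have hsign : 0 ≤ (1 - x⁻¹) * (1 - x ^ (-N)) := by
    rcases le_or_gt 1 x with h1 | h1
    · have ha : x⁻¹ ≤ 1 := inv_le_one_of_one_le₀ h1
      have hb : x ^ (-N) ≤ 1 := Real.rpow_le_one_of_one_le_of_nonpos h1 (by linarith)
      exact mul_nonneg (by linarith) (by linarith)
    · have ha : 1 ≤ x⁻¹ := (one_le_inv₀ hx).mpr h1.le
      have hb : 1 ≤ x ^ (-N) := Real.one_le_rpow_of_pos_of_le_one_of_nonpos hx h1.le (by linarith)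
      exact mul_nonneg_of_nonpos_of_nonpos (by linarith) (by linarith)
  nlinarith [hsign]

/-- For `t ≥ 0`, `N ≥ 0`: `(1 + t)^N · (1 + t) = (1 + t)^{N+1}`. -/
theorem one_add_rpow_mul_one_add {t N : ℝ} (ht : 0 ≤ t) : (1 + t) ^ N * (1 + t) = (1 + t) ^ (N + 1) := by
  rw [Real.rpow_add_one (by linarith : (1 + t : ℝ) ≠ 0)]

end Summit.HodgeConjecture.HodgeConjecture.Cruxes.HLiu418.K2LiuHermTwoInvMulEtaGrowth

end
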